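/-
Copyright (c) 2026 the pub-hodgecm-mathlib formalisation cell (harness21).  Prover seat hodgecm-mathlib-K2Liu-p02 (g4), Track B «K2-LIT» ∕
hLiu418 #184♮, socket #42N «MODEL IDENTIFICATION» of the #42R road, FILE (P2, group side) of road (N″) «by the see-saw permutation»
(LEAD F0P6-plan (g11) rulings «M-155k», «M-155m» (2)), 2026-09-04.
-/
import Summits.HodgeConjecture.HodgeConjecture.Theorems.K2LiuUndoublingSeesawPermutation
import Literature.NumberTheory.Automorphic.UnitaryGroupLevelTransport

/-!
# Crux `HLiu418`, road `K2_Liu`, socket #42N — FILE (P2, group side): the see-saw permutation is a RATIONAL point of `H(V)`,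
# and `H(V₁) = U(V)` for `V = V₁ ⊕ (−V₁)`

Cell `hodgecm-mathlib`, crux item hLiu418 = `stmt-HodgeConjecture-24832`; squad K2 ∕ K2Liu, prover K2Liu-p02 (g4), steward lineage of socket #42R.
THEOREMS ONLY (no `def` ∕ instance ∕ notation ∕ named-fact hypothesis ∕ `sorry`); lane `--supports stmt-HodgeConjecture-24832 --as helper`
(count-neutral).  Sequel of ★ `K2LiuUndoublingSeesawPermutation` (FILE (P1): `inlG Y = (permGL ρ)⁻¹ · blkD (h₁, 1) · permGL ρ` as matrices).

For the pair datum `(V, W)` with `V` of rank `N + N` diagonalised by `dV` with **`V₂ = −V₁`** (`hV : dV (natAdd i) = −dV (castAdd i)`),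
`W = ⟨dW 0⟩` a line (`M = 1`), and the enumerations `e₁ : Fin (N+N) × Fin 1 ≃ Fin n_V`, `e₀ : Fin N × Fin 1 ≃ Fin N` with `e₀⁻¹ m = (m, 0)`:

* §1 **the see-saw permutation `ρ = seesawPerm e₁ e₀` preserves the doubled Gram matrix**: `T^𝔻_V.submatrix ρ ρ = T^𝔻_V`
  (`gramD_submatrix_seesawPerm`; entrywise `gramDiag_seesawPerm` — the two swapped blocks «`V₂` of copy 1» and «`V₁⁻` of copy 2» carry
  the SAME Gram datum `−t₀(V₁ ⊗ W)`), hence `J^𝔻_V` and `J^𝔻_V ⊗ 𝔸` too;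
* §2 **`permGL ρ` is unitary and rational**: `permGL ρ ∈ U(σ, J)` whenever `J.submatrix ρ ρ = J` (`permGL_mem_unitaryGroupOfForm`, any ring), so
  `permGL ρ ∈ H(V)(L⁺)` (`permGL_seesawPerm_mem_rational`), `∈ H(V)(𝔸)` (`permGL_seesawPerm_mem_HA`), and the adelic point is the image of
  the rational one (`toAdelic_permGL_seesawPerm`, `permGL_seesawPerm_mem_ratH`);
* §3 **`H(V₁) = U(V)`** (`V₁` diagonalised by `dA = dV ∘ castAdd`): `J^𝔻_{V₁} = (dW 0) · diag dV` (`hermD_e₀_eq_smul_diagonal`), so for `dW 0 ≠ 0`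
  the rational and adelic groups of the doubled datum of `V₁` ARE those of the hermitian space `V` inside the same `GL_{N+N}`
  (`rational_hermD_e₀_eq`, `HA_e₀_eq_adelic`, `mem_ratH_e₀_iff`), the matrix of `a(x) = x ⊗ 1` on the line is `x` (`coe_adelicInl_apply_zero`),
  and FILE (P1) becomes the identity **`inlG (x ⊗ 1) = δ′⁻¹ · blkD (x, 1) · δ′` IN `H(V)(𝔸)`**, `δ′ = permGL ρ ∈ H(V)(L⁺)`
  (`inlG_adelicInl_eq_conj_blkD`).

These are the group-theoretic inputs of FILE (P3) (assembly with ★ `omega_blkD_inl_sumTensor` and the Weil-side lemma of K2E2-p12 (g3)).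

HONEST LABEL.  Count-neutral helper; it pays nothing by itself: `HC_CM` is proved only modulo the 7 printed citations (2 remaining named inputs:
hLiu418 = `stmt-HodgeConjecture-24832`, h413 = `stmt-HodgeConjecture-24833`) until rung 0 closes.
References: [Kudla1984] §1 (see-saw pairs); [Kudla1994] §2 (doubled space, Siegel parabolic); [HarrisKudlaSweet1996] §1 (1.9), (1.14)–(1.15),
App. A Lem. A.2; [GelbartRogawski1991] §3.1 Prop. 3.1.1; [PlatonovRapinchuk1994] §2.3 (unitary group of a rescaled form).
-/

set_option autoImplicit false
-- the mandated namespace repeats the single-problem summit's segment (`HodgeConjecture.HodgeConjecture`)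
set_option linter.dupNamespace false

noncomputable section

open scoped Classical Matrix Kronecker
open NumberField IsDedekindDomain
open Literature.NumberTheory.Automorphic hiding permGL coe_permGL
open Literature.NumberTheory.GelbartRogawski1991.GRConstruction Literature.NumberTheory.GelbartRogawski1991.UnitaryDualPair
open Summit.HodgeConjecture.HodgeConjecture.Cruxes.HLiu418.K2LiuUndoublingSeesawPermutation

namespace Summit.HodgeConjecture.HodgeConjecture.Cruxes.HLiu418.K2LiuUndoublingSeesawPermutationMem

/-! ## §2₀ Permutation matrices preserving a form are unitary (any ring) -/

section Perm

variable {R : Type*} [CommRing R] {m : Type*} [Fintype m] [DecidableEq m]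

/-- the transpose of the matrix of `permGL ρ` is the matrix of `(permGL ρ)⁻¹`. [cite: Kudla1984, §1] -/
theorem transpose_coe_permGL (ρ : m ≃ m) :
    (((K2LiuUndoublingSeesawPermutation.permGL ρ : GL m R) : Matrix m m R))ᵀ =
      (((K2LiuUndoublingSeesawPermutation.permGL ρ)⁻¹ : GL m R) : Matrix m m R) := by
  rw [K2LiuUndoublingSeesawPermutation.coe_permGL, coe_permGL_inv, Equiv.toPEquiv_symm, PEquiv.toMatrix_symm,
    Matrix.transpose_transpose]

/-- **a permutation matrix preserving the form is unitary**: `J.submatrix ρ ρ = J → permGL ρ ∈ U(σ, J)` (its entries are `0, 1`, fixed by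
`σ`, and `ᵗP J P = J.submatrix ρ ρ`). [cite: PlatonovRapinchuk1994, §2.3] [cite: Kudla1984, §1] -/
theorem permGL_mem_unitaryGroupOfForm (σ : R →+* R) {J : Matrix m m R} (ρ : m ≃ m) (hJ : J.submatrix ρ ρ = J) :
    (K2LiuUndoublingSeesawPermutation.permGL ρ : GL m R) ∈ unitaryGroupOfForm σ J := by
  rw [mem_unitaryGroupOfForm_iff]
  have hmap : ((K2LiuUndoublingSeesawPermutation.permGL ρ : GL m R) : Matrix m m R).map σ =
      ((K2LiuUndoublingSeesawPermutation.permGL ρ : GL m R) : Matrix m m R) := by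
    rw [K2LiuUndoublingSeesawPermutation.coe_permGL, toPEquiv_toMatrix_map]
  rw [hmap, transpose_coe_permGL, permGL_inv_mul_mul, hJ]

end Perm

/-! ## §1 The see-saw permutation preserves the doubled Gram matrix -/

section Gram

variable (L : Type) [Field L] [NumberField L] [IsCMField L]
variable {N nV : ℕ} (e₁ : Fin (N + N) × Fin 1 ≃ Fin nV) (e₀ : Fin N × Fin 1 ≃ Fin N) (he₀ : ∀ m, (e₀.symm m).1 = m)
  (dV : Fin (N + N) → L) (hdV : ∀ i, IsCMField.complexConj L (dV i) = dV i)
  (hV : ∀ i, dV (Fin.natAdd N i) = -dV (Fin.castAdd N i))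
  (dW : Fin 1 → L) (hdW : ∀ i, IsCMField.complexConj L (dW i) = dW i)

/-- `t₀(V ⊗ W) a = dV (rowEquiv⁻¹ a) · dW 0`. [cite: HarrisKudlaSweet1996, §1 (1.9)] -/
theorem coe_cmGramEntry_e₁ (a : Fin nV) :
    ((cmGramEntry L e₁ dV hdV dW hdW a : Fp L) : L) = dV ((rowEquiv e₁).symm a) * dW 0 := by
  rw [coe_cmGramEntry, e₁_symm_eq]

include he₀ in
/-- `t₀(V₁ ⊗ W) i = d i · dW 0` for an enumeration with `e₀⁻¹ m = (m, 0)`. [cite: HarrisKudlaSweet1996, §1 (1.9)] -/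
theorem coe_cmGramEntry_e₀ (d : Fin N → L) (hd : ∀ i, IsCMField.complexConj L (d i) = d i) (i : Fin N) :
    ((cmGramEntry L e₀ d hd dW hdW i : Fp L) : L) = d i * dW 0 := by
  have h2 : (e₀.symm i).2 = 0 := Fin.eq_zero _
  rw [coe_cmGramEntry, he₀, h2]

include he₀ in
/-- `t₀(V ⊗ W) (idxSplit⁻¹ (inl i)) = dV (castAdd i) · dW 0` (`σ = idxSplit e₁ e₀ e₀`). [cite: HarrisKudlaSweet1996, §1 (1.9)] [cite: Kudla1984, §1] -/
theorem coe_cmGramEntry_idxSplit_symm_inl (i : Fin N) :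
    ((cmGramEntry L e₁ dV hdV dW hdW ((idxSplit e₁ e₀ e₀).symm (Sum.inl i)) : Fp L) : L) = dV (Fin.castAdd N i) * dW 0 := by
  have h2 : (e₀.symm i).2 = 0 := Fin.eq_zero _
  rw [coe_cmGramEntry, eV_symm_idxSplit_symm_inl, he₀, h2]

include he₀ in
/-- `t₀(V ⊗ W) (idxSplit⁻¹ (inr i)) = dV (natAdd i) · dW 0`. [cite: HarrisKudlaSweet1996, §1 (1.9)] [cite: Kudla1984, §1] -/
theorem coe_cmGramEntry_idxSplit_symm_inr (i : Fin N) :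
    ((cmGramEntry L e₁ dV hdV dW hdW ((idxSplit e₁ e₀ e₀).symm (Sum.inr i)) : Fp L) : L) = dV (Fin.natAdd N i) * dW 0 := by
  have h2 : (e₀.symm i).2 = 0 := Fin.eq_zero _
  rw [coe_cmGramEntry, eV_symm_idxSplit_symm_inr, he₀, h2]

include he₀ hV in
/-- **the swapped blocks carry the same Gram datum**: the diagonal `(t₀ ⊕ (−t₀)) ∘ e₂⁻¹` of `T^𝔻_V` is invariant under the see-saw
permutation `ρ` — «`V₂` of copy 1» has entries `t₀(V₂ ⊗ W) = −t₀(V₁ ⊗ W)`, exactly those of «`V₁⁻` of copy 2», and symmetrically.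
[cite: HarrisKudlaSweet1996, §1 (1.9)] [cite: Kudla1984, §1] -/
theorem gramDiag_seesawPerm (k : Fin (nV + nV)) :
    Sum.elim (cmGramEntry L e₁ dV hdV dW hdW) (-cmGramEntry L e₁ dV hdV dW hdW)
        ((finSumFinEquiv (m := nV) (n := nV)).symm (seesawPerm e₁ e₀ k)) =
      Sum.elim (cmGramEntry L e₁ dV hdV dW hdW) (-cmGramEntry L e₁ dV hdV dW hdW) ((finSumFinEquiv (m := nV) (n := nV)).symm k) := by
  obtain ⟨z, rfl⟩ := (finSumFinEquiv (m := nV) (n := nV)).surjective k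
  have hρ : seesawPerm e₁ e₀ (finSumFinEquiv z) =
      (idxSplitD e₁ e₀ e₀).symm (Sum.map (rowEquiv e₁).symm (rowEquiv e₁).symm z) := by
    rw [Equiv.eq_symm_apply, idxSplitD_seesawPerm_finSumFinEquiv]
  rw [hρ, Equiv.symm_apply_apply]
  rcases z with a | a
  · obtain ⟨w, hw⟩ := (finSumFinEquiv (m := N) (n := N)).surjective ((rowEquiv e₁).symm a)
    rw [Sum.map_inl, ← hw, Sum.elim_inl]
    rcases w with i | i
    · rw [idxSplitD_symm_inl_inl, Equiv.symm_apply_apply, Sum.elim_inl]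
      apply Subtype.ext
      rw [coe_cmGramEntry_idxSplit_symm_inl L e₁ e₀ he₀, coe_cmGramEntry_e₁, ← hw, finSumFinEquiv_apply_left]
    · rw [idxSplitD_symm_inl_inr, Equiv.symm_apply_apply, Sum.elim_inr, Pi.neg_apply]
      apply Subtype.ext
      rw [NegMemClass.coe_neg, coe_cmGramEntry_idxSplit_symm_inl L e₁ e₀ he₀, coe_cmGramEntry_e₁, ← hw, finSumFinEquiv_apply_right,
        hV, neg_mul]
  · obtain ⟨w, hw⟩ := (finSumFinEquiv (m := N) (n := N)).surjective ((rowEquiv e₁).symm a)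
    rw [Sum.map_inr, ← hw, Sum.elim_inr, Pi.neg_apply]
    rcases w with i | i
    · rw [idxSplitD_symm_inr_inl, Equiv.symm_apply_apply, Sum.elim_inl]
      apply Subtype.ext
      rw [NegMemClass.coe_neg, coe_cmGramEntry_idxSplit_symm_inr L e₁ e₀ he₀, coe_cmGramEntry_e₁, ← hw, finSumFinEquiv_apply_left,
        hV, neg_mul]
    · rw [idxSplitD_symm_inr_inr, Equiv.symm_apply_apply, Sum.elim_inr, Pi.neg_apply]
      apply Subtype.ext
      rw [NegMemClass.coe_neg, NegMemClass.coe_neg, coe_cmGramEntry_idxSplit_symm_inr L e₁ e₀ he₀, coe_cmGramEntry_e₁, ← hw,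
        finSumFinEquiv_apply_right]

include he₀ hV in
/-- **`T^𝔻_V.submatrix ρ ρ = T^𝔻_V`** for the see-saw permutation `ρ`. [cite: HarrisKudlaSweet1996, §1 (1.9)] [cite: Kudla1984, §1] -/
theorem gramD_submatrix_seesawPerm :
    (gramD L e₁ dV hdV dW hdW).submatrix (seesawPerm e₁ e₀) (seesawPerm e₁ e₀) = gramD L e₁ dV hdV dW hdW := by
  rw [gramD_eq_diagonal, Matrix.submatrix_diagonal_equiv]
  congr 1
  funext k
  exact gramDiag_seesawPerm L e₁ e₀ he₀ dV hdV hV dW hdW k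

include he₀ hV in
/-- `J^𝔻_V.submatrix ρ ρ = J^𝔻_V`. [cite: HarrisKudlaSweet1996, §1 (1.9)] [cite: Kudla1984, §1] -/
theorem hermD_submatrix_seesawPerm :
    (hermD L e₁ dV hdV dW hdW).submatrix (seesawPerm e₁ e₀) (seesawPerm e₁ e₀) = hermD L e₁ dV hdV dW hdW := by
  rw [hermD, Matrix.submatrix_map, gramD_submatrix_seesawPerm L e₁ e₀ he₀ dV hdV hV dW hdW]

include he₀ hV in
/-- `(J^𝔻_V ⊗ 𝔸).submatrix ρ ρ = J^𝔻_V ⊗ 𝔸`. [cite: HarrisKudlaSweet1996, §1 (1.9)] [cite: Kudla1984, §1] -/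
theorem adelicForm_hermD_submatrix_seesawPerm :
    (UnitaryGroup.adelicForm L (nV + nV) (hermD L e₁ dV hdV dW hdW)).submatrix (seesawPerm e₁ e₀) (seesawPerm e₁ e₀) =
      UnitaryGroup.adelicForm L (nV + nV) (hermD L e₁ dV hdV dW hdW) := by
  rw [UnitaryGroup.adelicForm, Matrix.submatrix_map, hermD_submatrix_seesawPerm L e₁ e₀ he₀ dV hdV hV dW hdW]

/-! ## §2 `permGL ρ` is a rational point of `H(V)` -/

include he₀ hV in
/-- **`permGL ρ ∈ H(V)(L⁺)`** (the rational unitary group of `J^𝔻_V`). [cite: Kudla1984, §1] [cite: Kudla1994, §2 (doubled space, Siegel parabolic)] -/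
theorem permGL_seesawPerm_mem_rational :
    (K2LiuUndoublingSeesawPermutation.permGL (seesawPerm e₁ e₀) : GL (Fin (nV + nV)) L) ∈
      UnitaryGroup.rational (Fp L) L (IsCMField.complexConj L) (nV + nV) (hermD L e₁ dV hdV dW hdW) :=
  permGL_mem_unitaryGroupOfForm _ _ (hermD_submatrix_seesawPerm L e₁ e₀ he₀ dV hdV hV dW hdW)

include he₀ hV in
/-- **`permGL ρ ∈ H(V)(𝔸)`**. [cite: Kudla1984, §1] [cite: Kudla1994, §2 (doubled space, Siegel parabolic)] -/
theorem permGL_seesawPerm_mem_HA :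
    (K2LiuUndoublingSeesawPermutation.permGL (seesawPerm e₁ e₀) : GL (Fin (nV + nV)) (AdeleRing (𝓞 L) L)) ∈ HA L e₁ dV hdV dW hdW :=
  permGL_mem_unitaryGroupOfForm _ _ (adelicForm_hermD_submatrix_seesawPerm L e₁ e₀ he₀ dV hdV hV dW hdW)

include he₀ hV in
/-- the adelic point `permGL ρ ∈ H(V)(𝔸)` is the image of the rational point `permGL ρ ∈ H(V)(L⁺)`. [cite: Kudla1984, §1] -/
theorem toAdelic_permGL_seesawPerm :
    UnitaryGroup.toAdelic (Fp L) L (IsCMField.complexConj L) (nV + nV) (hermD L e₁ dV hdV dW hdW)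
        ⟨K2LiuUndoublingSeesawPermutation.permGL (seesawPerm e₁ e₀), permGL_seesawPerm_mem_rational L e₁ e₀ he₀ dV hdV hV dW hdW⟩ =
      ⟨K2LiuUndoublingSeesawPermutation.permGL (seesawPerm e₁ e₀), permGL_seesawPerm_mem_HA L e₁ e₀ he₀ dV hdV hV dW hdW⟩ :=
  Subtype.ext (map_permGL (seesawPerm e₁ e₀) (algebraMap L (AdeleRing (𝓞 L) L)))

include he₀ hV in
/-- **`permGL ρ ∈ H(V)(L⁺) ≤ H(V)(𝔸)`** (`ratH`, the range of `toAdelic`). [cite: Kudla1984, §1] [cite: Kudla1994, §2 (doubled space, Siegel parabolic)] -/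
theorem permGL_seesawPerm_mem_ratH :
    (⟨K2LiuUndoublingSeesawPermutation.permGL (seesawPerm e₁ e₀), permGL_seesawPerm_mem_HA L e₁ e₀ he₀ dV hdV hV dW hdW⟩ :
        ↥(HA L e₁ dV hdV dW hdW)) ∈ ratH L e₁ dV hdV dW hdW :=
  ⟨_, toAdelic_permGL_seesawPerm L e₁ e₀ he₀ dV hdV hV dW hdW⟩

/-! ## §3 `H(V₁) = U(V)` for `V = V₁ ⊕ (−V₁)` and a line `W` -/

variable (dA : Fin N → L) (hdA : ∀ i, IsCMField.complexConj L (dA i) = dA i) (hVA : ∀ i, dV (Fin.castAdd N i) = dA i)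

include he₀ hV hVA in
/-- **`J^𝔻_{V₁} = (dW 0) · diag dV`**: the hermitian Gram matrix of the DOUBLED space of `V₁` (diagonalised by `dA = dV ∘ castAdd`, partner the
line `⟨dW 0⟩`, enumeration `e₀⁻¹ m = (m, 0)`) is the Gram matrix `diag dV = diag (dA ‖ −dA)` of `V = V₁ ⊕ (−V₁)` rescaled by `dW 0`.
[cite: Kudla1994, §2 (doubled space, Siegel parabolic)] [cite: HarrisKudlaSweet1996, §1 (1.9)] -/
theorem hermD_e₀_eq_smul_diagonal : hermD L e₀ dA hdA dW hdW = dW 0 • Matrix.diagonal dV := by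
  rw [hermD, gramD_eq_diagonal, Matrix.diagonal_map (map_zero _), ← Matrix.diagonal_smul]
  congr 1
  funext k
  obtain ⟨z, rfl⟩ := (finSumFinEquiv (m := N) (n := N)).surjective k
  have hc : ∀ x : Fp L, algebraMap (Fp L) L x = (x : L) := fun x => rfl
  rw [Equiv.symm_apply_apply, Pi.smul_apply, smul_eq_mul, hc]
  rcases z with i | i
  · rw [Sum.elim_inl, coe_cmGramEntry_e₀ L e₀ he₀ dW hdW, finSumFinEquiv_apply_left, hVA, mul_comm]
  · rw [Sum.elim_inr, Pi.neg_apply, NegMemClass.coe_neg, coe_cmGramEntry_e₀ L e₀ he₀ dW hdW, finSumFinEquiv_apply_right, hV, hVA,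
      mul_neg, mul_comm]

include he₀ hV hVA in
/-- **`H(V₁)(L⁺) = U(V)(L⁺)`** inside `GL_{N+N}(L)`, for `dW 0 ≠ 0`. [cite: PlatonovRapinchuk1994, §2.3] [cite: Kudla1994, §2 (doubled space, Siegel parabolic)] -/
theorem rational_hermD_e₀_eq (hW : dW 0 ≠ 0) :
    UnitaryGroup.rational (Fp L) L (IsCMField.complexConj L) (N + N) (hermD L e₀ dA hdA dW hdW) =
      UnitaryGroup.rational (Fp L) L (IsCMField.complexConj L) (N + N) (Matrix.diagonal dV) := by
  unfold UnitaryGroup.rational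
  rw [hermD_e₀_eq_smul_diagonal L e₀ he₀ dV hV dW hdW dA hdA hVA, unitaryGroupOfForm_smul_of_isUnit _ (isUnit_iff_ne_zero.mpr hW)]

include he₀ hV hVA in
/-- `J^𝔻_{V₁} ⊗ 𝔸 = (dW 0) · (diag dV ⊗ 𝔸)`. [cite: Kudla1994, §2 (doubled space, Siegel parabolic)] -/
theorem adelicForm_hermD_e₀_eq :
    UnitaryGroup.adelicForm L (N + N) (hermD L e₀ dA hdA dW hdW) =
      algebraMap L (AdeleRing (𝓞 L) L) (dW 0) • UnitaryGroup.adelicForm L (N + N) (Matrix.diagonal dV) := by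
  rw [UnitaryGroup.adelicForm, UnitaryGroup.adelicForm, hermD_e₀_eq_smul_diagonal L e₀ he₀ dV hV dW hdW dA hdA hVA,
    Matrix.map_smul' _ _ _ (map_mul (algebraMap L (AdeleRing (𝓞 L) L)))]

include he₀ hV hVA in
/-- **`H(V₁)(𝔸) = U(V)(𝔸)`** inside `GL_{N+N}(𝔸_L)`, for `dW 0 ≠ 0`: the adelic group of the doubled datum of `V₁` with partner the line
`⟨dW 0⟩` IS the adelic unitary group of `V = V₁ ⊕ (−V₁)`. [cite: PlatonovRapinchuk1994, §2.3] [cite: Kudla1994, §2 (doubled space, Siegel parabolic)] -/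
theorem HA_e₀_eq_adelic (hW : dW 0 ≠ 0) :
    HA L e₀ dA hdA dW hdW = UnitaryGroup.adelic (Fp L) L (IsCMField.complexConj L) (N + N) (Matrix.diagonal dV) := by
  show UnitaryGroup.adelic (Fp L) L (IsCMField.complexConj L) (N + N) (hermD L e₀ dA hdA dW hdW) = _
  unfold UnitaryGroup.adelic
  rw [adelicForm_hermD_e₀_eq L e₀ he₀ dV hV dW hdW dA hdA hVA,
    unitaryGroupOfForm_smul_of_isUnit _ ((isUnit_iff_ne_zero.mpr hW).map _)]

include he₀ hV hVA in
/-- **rational points correspond**: `h ∈ H(V₁)(L⁺) ≤ H(V₁)(𝔸)` iff its matrix is the image of a rational point of `U(V)`.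
[cite: PlatonovRapinchuk1994, §2.3] [cite: Kudla1994, §2 (doubled space, Siegel parabolic)] -/
theorem mem_ratH_e₀_iff (hW : dW 0 ≠ 0) (h : HA L e₀ dA hdA dW hdW) :
    h ∈ ratH L e₀ dA hdA dW hdW ↔
      ∃ g : UnitaryGroup.rational (Fp L) L (IsCMField.complexConj L) (N + N) (Matrix.diagonal dV),
        Matrix.GeneralLinearGroup.map (algebraMap L (AdeleRing (𝓞 L) L)) (g : GL (Fin (N + N)) L) =
          (h : GL (Fin (N + N)) (AdeleRing (𝓞 L) L)) := by
  have hrat := rational_hermD_e₀_eq L e₀ he₀ dV hV dW hdW dA hdA hVA hW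
  constructor
  · rintro ⟨γ, hγ⟩
    exact ⟨⟨γ.1, hrat ▸ γ.2⟩, congrArg Subtype.val hγ⟩
  · rintro ⟨g, hg⟩
    exact ⟨⟨g.1, hrat.symm ▸ g.2⟩, Subtype.ext hg⟩

omit [IsCMField L] in
/-- the matrix of `a(x) = x ⊗ 1` on a line: `(x ⊗ 1) (k,0) (k′,0) = x k k′`. [cite: GelbartRogawski1991, §3.2 p. 457] -/
theorem coe_adelicInl_apply_zero {c : L ≃ₐ[Fp L] L} {JV : Matrix (Fin (N + N)) (Fin (N + N)) L} {JW : Matrix (Fin 1) (Fin 1) L}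
    (x : UnitaryGroup.adelic (Fp L) L c (N + N) JV) (k k' : Fin (N + N)) :
    (((UnitaryGroup.adelicInl (Fp L) L c (N + N) 1 JV JW x : UnitaryGroup.adelicPair (Fp L) L c (N + N) 1 JV JW) :
        GL (Fin (N + N) × Fin 1) (AdeleRing (𝓞 L) L)) : Matrix (Fin (N + N) × Fin 1) (Fin (N + N) × Fin 1) (AdeleRing (𝓞 L) L))
        (k, (0 : Fin 1)) (k', (0 : Fin 1)) =
      ((x : GL (Fin (N + N)) (AdeleRing (𝓞 L) L)) : Matrix (Fin (N + N)) (Fin (N + N)) (AdeleRing (𝓞 L) L)) k k' := by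
  rw [UnitaryGroup.coe_adelicInl, Matrix.kronecker_apply, Matrix.one_apply_eq, mul_one]

variable (dB : Fin N → L) (hdB : ∀ i, IsCMField.complexConj L (dB i) = dB i) (hVB : ∀ j, dV (Fin.natAdd N j) = dB j)

include he₀ hV in
/-- **`inlG (x ⊗ 1) = δ′⁻¹ · blkD (x, 1) · δ′` in `H(V)(𝔸)`**, `δ′ = permGL ρ ∈ H(V)(L⁺)`: for `x ∈ U(V)(𝔸) = H(V₁)(𝔸)` (`HA_e₀_eq_adelic`) the
embedding `x ↦ x ⊗ 1 ↦ (x ⊗ 1) ⊕ 1` of the pair datum `(V, W)` is the see-saw embedding `blkD (·, 1)` of `H(V₁)(𝔸)` conjugated by the rational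
point `δ′` — the group-level half of «`ι̃_{V,χ}` is determined by doubling». [cite: HarrisKudlaSweet1996, App. A Lem. A.2]
[cite: Kudla1994, §2 (doubled space, Siegel parabolic)] [cite: Kudla1984, §1] -/
theorem inlG_adelicInl_eq_conj_blkD (hW : dW 0 ≠ 0)
    (x : UnitaryGroup.adelic (Fp L) L (IsCMField.complexConj L) (N + N) (Matrix.diagonal dV)) :
    inlG L e₁ dV hdV dW hdW
        (UnitaryGroup.adelicInl (Fp L) L (IsCMField.complexConj L) (N + N) 1 (Matrix.diagonal dV) (Matrix.diagonal dW) x) =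
      (⟨K2LiuUndoublingSeesawPermutation.permGL (seesawPerm e₁ e₀), permGL_seesawPerm_mem_HA L e₁ e₀ he₀ dV hdV hV dW hdW⟩ :
          ↥(HA L e₁ dV hdV dW hdW))⁻¹ *
        blkD L e₁ e₀ e₀ dA hdA dB hdB dV hdV hVA hVB dW hdW
          (⟨(x : GL (Fin (N + N)) (AdeleRing (𝓞 L) L)), (HA_e₀_eq_adelic L e₀ he₀ dV hV dW hdW dA hdA hVA hW).symm ▸ x.2⟩, 1) *
        ⟨K2LiuUndoublingSeesawPermutation.permGL (seesawPerm e₁ e₀), permGL_seesawPerm_mem_HA L e₁ e₀ he₀ dV hdV hV dW hdW⟩ := by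
  apply Subtype.ext
  apply Units.ext
  rw [Subgroup.coe_mul, Subgroup.coe_mul, Subgroup.coe_inv, Units.val_mul, Units.val_mul]
  exact coe_inlG_eq_conj_blkD L e₁ e₀ dA hdA dB hdB dV hdV hVA hVB dW hdW _ _ (coe_adelicInl_apply_zero L x)

end Gram

end Summit.HodgeConjecture.HodgeConjecture.Cruxes.HLiu418.K2LiuUndoublingSeesawPermutationMem

end
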